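import Mathlib
import Literature.Analysis.FluidPDE.GalerkinFlow
import Literature.Analysis.FluidPDE.NSGalerkinTrajectory
import Literature.Analysis.FunctionSpaces.TorusLinearisedFormTruncation
import Summits.AnomalousDissipation.AnomalousDissipation.Theses.WazewskiBlock
import Summits.AnomalousDissipation.AnomalousDissipation.Theorems.WazewskiBlockUniformGalerkinTrapLandingEquivalence
import Summits.AnomalousDissipation.AnomalousDissipation.Theorems.WazewskiBlockUniformGalerkinTrapStubAeOrbitMem
import Summits.AnomalousDissipation.AnomalousDissipation.Theorems.WazewskiBlockUniformGalerkinTrapStubCalibration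
import Summits.AnomalousDissipation.AnomalousDissipation.Theorems.WazewskiBlockUniformGalerkinTrapStubGalerkinRegularity
import Summits.AnomalousDissipation.AnomalousDissipation.Theorems.WazewskiBlockUniformGalerkinTrapMeanToPointwise
import HarnessLib

/-!
# Crux `WazewskiBlock.UniformGalerkinTrap` (stmt-AnomalousDissipation-10352), line `SketchIdeator5`:
# the landed composition — the crux CLOSED MODULO THE BET `BoundedExcessLoudCore`

This file makes the whole proved part of the line importable: from the bet (an invariant Borel probability law of
the order-`N` Galerkin coefficient semiflow carried by the capped core, mean injection `β`, a.e. `L`-Lipschitz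
injection with cumulative `β`-excess `≤ C`, `√(2 C L) ≤ β - ε₀`, for all small `ν` and large `N`) to the crux BY NAME:

* `boundedDeficitLoudCore_of_boundedExcessLoudCore` — statistical ⇒ orbit level (truncated injection, a.e. orbit in
  the closed core `stub_aeOrbitMem`, Mañé calibration `stub_calibration`, selection of one good point; plumbing
  `stub_galerkinRegularity`);
* `uniformGalerkinTrap_of_boundedDeficitLoudCore` — orbit level ⇒ crux (floor lemma
  `floor_of_boundedDeficit`, forward orbit of `Torus.galerkinFlow`, landing equivalence p105977);
* `stub_uniformGalerkinTrap_of_boundedExcessLoudCore` — the registered tools stub: BET → crux.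

All statements are definition-free (the bet is spelled out verbatim as registered in the skeleton
`Cruxes/UniformGalerkinTrap/Lines/SketchIdeator5.lean`).
-/

noncomputable section

-- `Summit.<Summit>.<Problem>` is the tree's mandated summit-side namespace (CONVENTIONS §2); deliberate duplicate.
set_option linter.dupNamespace false

namespace Summit.AnomalousDissipation.AnomalousDissipation.Theorems.UniformGalerkinTrap.Mane

open scoped InnerProductSpace ENNReal NNReal
open MeasureTheory Set Filter Topology
open Literature.Analysis.FunctionSpaces Literature.Analysis.FunctionSpaces.Torus
open Literature.Analysis.FluidPDE
open Summit.AnomalousDissipation.AnomalousDissipation.Theorems.UniformGalerkinTrap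
  (uniformGalerkinTrap_iff_windowInvariantSets)

/-- **Statistical ⇒ orbit level (`BoundedExcessLoudCore → BoundedDeficitLoudCore`).** The bet's invariant law is
carried by the closed capped core, so a.e. forward orbit stays in it (`stub_aeOrbitMem`); on the core the injection is
bounded by `‖f‖₂(2E)^{1/2}`, so its truncation at that level is a bounded continuous observable with the same mean and
the same excess along a.e. orbit; Mañé's lemma (`stub_calibration`) bounds the DEFICIT along a.e. orbit; one point
with all three a.e. properties (orbit in the core, calibrated, Lipschitz injection) is selected. [folklore] -/
theorem boundedDeficitLoudCore_of_boundedExcessLoudCore :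
    (∃ (m : ℕ) (f : UnitAddTorus (Fin 3) → EuclideanSpace ℝ (Fin 3)),
      ((IsSmooth f ∧ IsDivFree f ∧ ∀ k : Fin 3 → ℤ, ((m : ℕ) : ℝ) ^ 2 < freqNormSq k →
        UnitAddTorus.mFourierCoeff (EuclideanSpace.complexify ∘ f) k = 0) ∧ HasZeroMean f) ∧
      ∃ (E ε₀ ν₀ : ℝ), 0 < ε₀ ∧ 0 < ν₀ ∧
        ∀ ν : ℝ, 0 < ν → ν ≤ ν₀ → ∃ (G : ℝ≥0) (N₀ : ℕ), ∀ N : ℕ, N₀ ≤ N →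
          ∃ (β C L : ℝ) (μ : Measure (↥(freqBall (d := Fin 3) N) → EuclideanSpace ℂ (Fin 3))),
            0 ≤ L ∧ Real.sqrt (2 * C * L) ≤ β - ε₀ ∧
            IsProbabilityMeasure μ ∧
            (∀ t : ℝ, 0 ≤ t →
              μ.map (galerkinCoeffFlow ν (fourierRestrict (freqBall (d := Fin 3) N) f) t) = μ) ∧
            μ {c : ↥(freqBall (d := Fin 3) N) → EuclideanSpace ℂ (Fin 3) |
                c ∈ galerkinSubspace (freqBall (d := Fin 3) N) ∧
                kineticEnergy (realTrigPoly (freqBall N) (coeffExt (freqBall N) c)) ≤ E ∧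
                eGradNormSq (realTrigPoly (freqBall N) (coeffExt (freqBall N) c)) ≤ (G : ℝ≥0∞)}ᶜ = 0 ∧
            ∫ c, (∫ x, ⟪f x, realTrigPoly (freqBall N) (coeffExt (freqBall N) c) x⟫_ℝ) ∂μ = β ∧
            (∀ᵐ c ∂μ, ∀ s t : ℝ, 0 ≤ s → 0 ≤ t →
              |(∫ x, ⟪f x, realTrigPoly (freqBall N) (coeffExt (freqBall N)
                  (galerkinCoeffFlow ν (fourierRestrict (freqBall (d := Fin 3) N) f) t c)) x⟫_ℝ) -
                ∫ x, ⟪f x, realTrigPoly (freqBall N) (coeffExt (freqBall N)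
                  (galerkinCoeffFlow ν (fourierRestrict (freqBall (d := Fin 3) N) f) s c)) x⟫_ℝ| ≤
                L * |t - s|) ∧
            (∀ᵐ c ∂μ, ∀ t : ℝ, 0 ≤ t →
              ∫ τ in (0 : ℝ)..t, (∫ x, ⟪f x, realTrigPoly (freqBall N) (coeffExt (freqBall N)
                (galerkinCoeffFlow ν (fourierRestrict (freqBall (d := Fin 3) N) f) τ c)) x⟫_ℝ) ≤
                β * t + C)) →
    ∃ (m : ℕ) (f : UnitAddTorus (Fin 3) → EuclideanSpace ℝ (Fin 3)),
      ((IsSmooth f ∧ IsDivFree f ∧ ∀ k : Fin 3 → ℤ, ((m : ℕ) : ℝ) ^ 2 < freqNormSq k →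
        UnitAddTorus.mFourierCoeff (EuclideanSpace.complexify ∘ f) k = 0) ∧ HasZeroMean f) ∧
      ∃ (E ε₀ ν₀ : ℝ), 0 < ε₀ ∧ 0 < ν₀ ∧
        ∀ ν : ℝ, 0 < ν → ν ≤ ν₀ → ∃ (G : ℝ≥0) (N₀ : ℕ), ∀ N : ℕ, N₀ ≤ N →
          ∃ (β C L : ℝ) (c : ↥(freqBall (d := Fin 3) N) → EuclideanSpace ℂ (Fin 3)),
            0 ≤ L ∧ Real.sqrt (2 * C * L) ≤ β - ε₀ ∧
            c ∈ galerkinSubspace (freqBall (d := Fin 3) N) ∧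
            (∀ t : ℝ, 0 ≤ t →
              kineticEnergy (realTrigPoly (freqBall N) (coeffExt (freqBall N)
                (galerkinCoeffFlow ν (fourierRestrict (freqBall (d := Fin 3) N) f) t c))) ≤ E ∧
              eGradNormSq (realTrigPoly (freqBall N) (coeffExt (freqBall N)
                (galerkinCoeffFlow ν (fourierRestrict (freqBall (d := Fin 3) N) f) t c))) ≤ (G : ℝ≥0∞)) ∧
            (∀ s t : ℝ, 0 ≤ s → 0 ≤ t →
              |(∫ x, ⟪f x, realTrigPoly (freqBall N) (coeffExt (freqBall N)
                  (galerkinCoeffFlow ν (fourierRestrict (freqBall (d := Fin 3) N) f) t c)) x⟫_ℝ) -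
                ∫ x, ⟪f x, realTrigPoly (freqBall N) (coeffExt (freqBall N)
                  (galerkinCoeffFlow ν (fourierRestrict (freqBall (d := Fin 3) N) f) s c)) x⟫_ℝ| ≤
                L * |t - s|) ∧
            (∀ s t : ℝ, 0 ≤ s → s ≤ t →
              β * (t - s) - C ≤ ∫ τ in s..t, (∫ x, ⟪f x, realTrigPoly (freqBall N) (coeffExt (freqBall N)
                (galerkinCoeffFlow ν (fourierRestrict (freqBall (d := Fin 3) N) f) τ c)) x⟫_ℝ)) := by
  rintro ⟨m, f, hF, E, ε₀, ν₀, hε₀, hν₀, hbet⟩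
  refine ⟨m, f, hF, E, ε₀, ν₀, hε₀, hν₀, fun ν hν hνle => ?_⟩
  obtain ⟨G, N₀, hN⟩ := hbet ν hν hνle
  refine ⟨G, N₀, fun N hN₀N => ?_⟩
  obtain ⟨β, C, L, μ, hL, hgap, hprob, hinv, hcore, hmean, hlipae, hexcess⟩ := hN N hN₀N
  have hfL2 : MemLp f 2 volume := hF.1.1.memLp 2
  -- tree plumbing for the coefficient semiflow of order `N`
  obtain ⟨hmeas, hcont, hsemi, hWcont, hKclosed⟩ := stub_galerkinRegularity ν N f E G hν.le hfL2
  have h0 : ∀ c : ↥(freqBall (d := Fin 3) N) → EuclideanSpace ℂ (Fin 3),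
      galerkinCoeffFlow ν (fourierRestrict (freqBall (d := Fin 3) N) f) 0 c = c :=
    fun c => galerkinCoeffFlow_zero c
  -- a.e. forward orbit stays in the (closed) capped core
  have haemem := stub_aeOrbitMem (galerkinCoeffFlow ν (fourierRestrict (freqBall (d := Fin 3) N) f)) μ
    {c : ↥(freqBall (d := Fin 3) N) → EuclideanSpace ℂ (Fin 3) |
        c ∈ galerkinSubspace (freqBall (d := Fin 3) N) ∧
        kineticEnergy (realTrigPoly (freqBall N) (coeffExt (freqBall N) c)) ≤ E ∧
        eGradNormSq (realTrigPoly (freqBall N) (coeffExt (freqBall N) c)) ≤ (G : ℝ≥0∞)}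
    hmeas h0 hcont hinv hKclosed hcore
  -- the injection is bounded on the core: `|∫⟪f, v⟫| ≤ ‖f‖₂ (2E)^{1/2}`
  set B : ℝ := Real.sqrt (∫ x, ‖f x‖ ^ 2) * Real.sqrt (2 * E) with hB
  have hB0 : 0 ≤ B := mul_nonneg (Real.sqrt_nonneg _) (Real.sqrt_nonneg _)
  have hWB : ∀ c : ↥(freqBall (d := Fin 3) N) → EuclideanSpace ℂ (Fin 3),
      kineticEnergy (realTrigPoly (freqBall N) (coeffExt (freqBall N) c)) ≤ E →
      |∫ x, ⟪f x, realTrigPoly (freqBall N) (coeffExt (freqBall N) c) x⟫_ℝ| ≤ B := by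
    intro c hKE
    refine (abs_integral_inner_le_sqrt_sq_mul_sqrt_sq hfL2 (memLp_realTrigPoly _ _ 2)).trans ?_
    refine mul_le_mul_of_nonneg_left (Real.sqrt_le_sqrt ?_) (Real.sqrt_nonneg _)
    have : ∫ x, ‖realTrigPoly (freqBall N) (coeffExt (freqBall N) c) x‖ ^ 2 =
        2 * kineticEnergy (realTrigPoly (freqBall N) (coeffExt (freqBall N) c)) := by
      simp only [kineticEnergy]; ring
    rw [this]; linarith
  -- the truncated injection: bounded, continuous, equal to the injection on the core
  obtain ⟨Wt, hWt_def⟩ : ∃ Wt : (↥(freqBall (d := Fin 3) N) → EuclideanSpace ℂ (Fin 3)) → ℝ,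
      Wt = fun c => max (-B) (min B (∫ x, ⟪f x, realTrigPoly (freqBall N) (coeffExt (freqBall N) c) x⟫_ℝ)) :=
    ⟨_, rfl⟩
  have hWtcont : Continuous Wt := by
    rw [hWt_def]; exact continuous_const.max (continuous_const.min hWcont)
  have hWtmeas : Measurable Wt := hWtcont.measurable
  have hWtb : ∃ B' : ℝ, ∀ c, |Wt c| ≤ B' := ⟨B, fun c => by
    rw [hWt_def]
    exact abs_le.2 ⟨le_max_left _ _, max_le (by linarith) (min_le_left _ _)⟩⟩
  have hWt_eq : ∀ c : ↥(freqBall (d := Fin 3) N) → EuclideanSpace ℂ (Fin 3),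
      kineticEnergy (realTrigPoly (freqBall N) (coeffExt (freqBall N) c)) ≤ E →
      Wt c = ∫ x, ⟪f x, realTrigPoly (freqBall N) (coeffExt (freqBall N) c) x⟫_ℝ := by
    intro c hKE
    have h := abs_le.1 (hWB c hKE)
    rw [hWt_def]
    simp only
    rw [min_eq_right h.2, max_eq_right h.1]
  have hWtorbit : ∀ c, ContinuousOn
      (fun t => Wt (galerkinCoeffFlow ν (fourierRestrict (freqBall (d := Fin 3) N) f) t c)) (Ici 0) :=
    fun c => hWtcont.comp_continuousOn (hcont c)
  -- the truncated injection has the same mean and the same excess bound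
  haveI := hprob
  have haeK : ∀ᵐ c ∂μ, c ∈ {c : ↥(freqBall (d := Fin 3) N) → EuclideanSpace ℂ (Fin 3) |
        c ∈ galerkinSubspace (freqBall (d := Fin 3) N) ∧
        kineticEnergy (realTrigPoly (freqBall N) (coeffExt (freqBall N) c)) ≤ E ∧
        eGradNormSq (realTrigPoly (freqBall N) (coeffExt (freqBall N) c)) ≤ (G : ℝ≥0∞)} :=
    mem_ae_iff.2 hcore
  have hmean' : ∫ c, Wt c ∂μ = β := by
    rw [← hmean]
    refine integral_congr_ae ?_
    filter_upwards [haeK] with c hc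
    exact hWt_eq c hc.2.1
  have hexcess' : ∀ᵐ c ∂μ, ∀ t : ℝ, 0 ≤ t →
      ∫ τ in (0 : ℝ)..t, Wt (galerkinCoeffFlow ν (fourierRestrict (freqBall (d := Fin 3) N) f) τ c) ≤
        β * t + C := by
    filter_upwards [hexcess, haemem] with c hc hmem
    intro t ht
    have heq : ∫ τ in (0 : ℝ)..t, Wt (galerkinCoeffFlow ν (fourierRestrict (freqBall (d := Fin 3) N) f) τ c) =
        ∫ τ in (0 : ℝ)..t, (∫ x, ⟪f x, realTrigPoly (freqBall N) (coeffExt (freqBall N)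
          (galerkinCoeffFlow ν (fourierRestrict (freqBall (d := Fin 3) N) f) τ c)) x⟫_ℝ) := by
      refine intervalIntegral.integral_congr fun τ hτ => ?_
      rw [uIcc_of_le ht] at hτ
      exact hWt_eq _ (hmem τ hτ.1).2.1
    rw [heq]; exact hc t ht
  -- Mañé calibration for the truncated injection
  have hcal := stub_calibration (galerkinCoeffFlow ν (fourierRestrict (freqBall (d := Fin 3) N) f)) μ Wt β C
    hmeas h0 hsemi hinv hWtmeas hWtb hWtorbit hmean' hexcess'
  -- select one calibrated point whose forward orbit stays in the core and has Lipschitz injection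
  obtain ⟨c, hmem, hdef, hlip⟩ := (haemem.and (hcal.and hlipae)).exists
  have hcK := hmem 0 le_rfl
  rw [h0 c] at hcK
  obtain ⟨hcV, -, -⟩ := hcK
  refine ⟨β, C, L, c, hL, hgap, hcV, fun t ht => (hmem t ht).2, hlip, fun s t hs hst => ?_⟩
  have h := hdef s t hs hst
  have heq : ∫ τ in s..t, Wt (galerkinCoeffFlow ν (fourierRestrict (freqBall (d := Fin 3) N) f) τ c) =
      ∫ τ in s..t, (∫ x, ⟪f x, realTrigPoly (freqBall N) (coeffExt (freqBall N)
        (galerkinCoeffFlow ν (fourierRestrict (freqBall (d := Fin 3) N) f) τ c)) x⟫_ℝ) := by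
    refine intervalIntegral.integral_congr fun τ hτ => ?_
    rw [uIcc_of_le hst] at hτ
    exact hWt_eq _ (hmem τ (hs.trans hτ.1)).2.1
  rwa [heq] at h


/-- **Orbit level ⇒ crux (`BoundedDeficitLoudCore → UniformGalerkinTrap`).** The floor lemma (with `L ≥ 0`,
`floor_of_boundedDeficit_of_nonneg`) gives injection `≥ ε₀` along the orbit; its field `realTrigPoly (φ_t c)‾ =
Torus.galerkinFlow ν f N t (realTrigPoly c̄)` sweeps a nonempty forward-invariant set of Galerkin modes in the window;
conclude by `uniformGalerkinTrap_iff_windowInvariantSets` (p105977). [folklore] -/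
theorem uniformGalerkinTrap_of_boundedDeficitLoudCore :
    (∃ (m : ℕ) (f : UnitAddTorus (Fin 3) → EuclideanSpace ℝ (Fin 3)),
      ((IsSmooth f ∧ IsDivFree f ∧ ∀ k : Fin 3 → ℤ, ((m : ℕ) : ℝ) ^ 2 < freqNormSq k →
        UnitAddTorus.mFourierCoeff (EuclideanSpace.complexify ∘ f) k = 0) ∧ HasZeroMean f) ∧
      ∃ (E ε₀ ν₀ : ℝ), 0 < ε₀ ∧ 0 < ν₀ ∧
        ∀ ν : ℝ, 0 < ν → ν ≤ ν₀ → ∃ (G : ℝ≥0) (N₀ : ℕ), ∀ N : ℕ, N₀ ≤ N →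
          ∃ (β C L : ℝ) (c : ↥(freqBall (d := Fin 3) N) → EuclideanSpace ℂ (Fin 3)),
            0 ≤ L ∧ Real.sqrt (2 * C * L) ≤ β - ε₀ ∧
            c ∈ galerkinSubspace (freqBall (d := Fin 3) N) ∧
            (∀ t : ℝ, 0 ≤ t →
              kineticEnergy (realTrigPoly (freqBall N) (coeffExt (freqBall N)
                (galerkinCoeffFlow ν (fourierRestrict (freqBall (d := Fin 3) N) f) t c))) ≤ E ∧
              eGradNormSq (realTrigPoly (freqBall N) (coeffExt (freqBall N)
                (galerkinCoeffFlow ν (fourierRestrict (freqBall (d := Fin 3) N) f) t c))) ≤ (G : ℝ≥0∞)) ∧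
            (∀ s t : ℝ, 0 ≤ s → 0 ≤ t →
              |(∫ x, ⟪f x, realTrigPoly (freqBall N) (coeffExt (freqBall N)
                  (galerkinCoeffFlow ν (fourierRestrict (freqBall (d := Fin 3) N) f) t c)) x⟫_ℝ) -
                ∫ x, ⟪f x, realTrigPoly (freqBall N) (coeffExt (freqBall N)
                  (galerkinCoeffFlow ν (fourierRestrict (freqBall (d := Fin 3) N) f) s c)) x⟫_ℝ| ≤
                L * |t - s|) ∧
            (∀ s t : ℝ, 0 ≤ s → s ≤ t →
              β * (t - s) - C ≤ ∫ τ in s..t, (∫ x, ⟪f x, realTrigPoly (freqBall N) (coeffExt (freqBall N)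
                (galerkinCoeffFlow ν (fourierRestrict (freqBall (d := Fin 3) N) f) τ c)) x⟫_ℝ))) →
    Summit.AnomalousDissipation.AnomalousDissipation.Theses.WazewskiBlock.UniformGalerkinTrap := by
  rintro ⟨m, f, hF, E, ε₀, ν₀, hε₀, hν₀, h⟩
  rw [uniformGalerkinTrap_iff_windowInvariantSets]
  refine ⟨m, f, hF, E, ε₀, ν₀, hε₀, hν₀, fun ν hν hνle => ?_⟩
  obtain ⟨G, N₀, hN⟩ := h ν hν hνle
  refine ⟨G, N₀, fun N hN₀ => ?_⟩
  obtain ⟨β, C, L, c, hL, hgap, hcV, horb, hlip, hdef⟩ := hN N hN₀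
  have hfi : Integrable f volume := (hF.1.1.memLp 2).integrable one_le_two
  -- the Galerkin mode swept by the coefficient orbit, and its field-level orbit
  have ha : IsGalerkinMode N (realTrigPoly (freqBall N) (coeffExt (freqBall N) c)) :=
    isGalerkinMode_realTrigPoly_coeffExt hcV
  have hflow : ∀ t : ℝ, Torus.galerkinFlow ν f N t (realTrigPoly (freqBall N) (coeffExt (freqBall N) c)) =
      realTrigPoly (freqBall N) (coeffExt (freqBall N)
        (galerkinCoeffFlow ν (fourierRestrict (freqBall N) f) t c)) :=
    fun t => Torus.galerkinFlow_realTrigPoly hcV t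
  -- the injection signal along the orbit
  obtain ⟨w, hw_def⟩ : ∃ w : ℝ → ℝ, w = fun t => ∫ x, ⟪f x, realTrigPoly (freqBall N) (coeffExt (freqBall N)
      (galerkinCoeffFlow ν (fourierRestrict (freqBall N) f) t c)) x⟫_ℝ := ⟨_, rfl⟩
  have hwlip : ∀ s t : ℝ, 0 ≤ s → 0 ≤ t → |w t - w s| ≤ L * |t - s| := fun s t hs ht => by
    rw [hw_def]; exact hlip s t hs ht
  have hwdef : ∀ s t : ℝ, 0 ≤ s → s ≤ t → β * (t - s) - C ≤ ∫ τ in s..t, w τ := fun s t hs hst => by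
    rw [hw_def]; exact hdef s t hs hst
  -- continuity on `[0,∞)` from the Lipschitz bound (with the positive constant `L + 1`)
  have hwcont : ContinuousOn w (Ici 0) := by
    rw [Metric.continuousOn_iff]
    intro t ht ε hε
    refine ⟨ε / (L + 1), div_pos hε (by linarith), fun s hs hst => ?_⟩
    rw [Real.dist_eq]
    have h1 : |w s - w t| ≤ L * |s - t| := hwlip t s ht hs
    have h2 : |s - t| < ε / (L + 1) := by rwa [← Real.dist_eq]
    have h3 : L * |s - t| ≤ (L + 1) * |s - t| :=
      mul_le_mul_of_nonneg_right (by linarith) (abs_nonneg _)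
    have h4 : (L + 1) * |s - t| < (L + 1) * (ε / (L + 1)) := mul_lt_mul_of_pos_left h2 (by linarith)
    have h5 : (L + 1) * (ε / (L + 1)) = ε := by field_simp
    linarith
  -- the pointwise floor along the orbit (floor lemma with `L ≥ 0`)
  have hfloor : ∀ t : ℝ, 0 ≤ t → ε₀ ≤ w t := by
    intro t ht
    have := floor_of_boundedDeficit_of_nonneg (w := w) hL hwcont hwlip hwdef t ht
    linarith
  refine ⟨(fun t => Torus.galerkinFlow ν f N t (realTrigPoly (freqBall N) (coeffExt (freqBall N) c))) '' Ici 0,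
    ⟨realTrigPoly (freqBall N) (coeffExt (freqBall N) c), 0, mem_Ici.2 le_rfl, Torus.galerkinFlow_zero _⟩,
    ?_, ?_, ?_⟩
  · rintro b ⟨τ, _, rfl⟩
    exact ha.isGalerkinMode_galerkinFlow τ
  · rintro b ⟨τ, hτ, rfl⟩ t ht
    exact ⟨t + τ, mem_Ici.2 (add_nonneg ht hτ), ha.galerkinFlow_add hν.le hfi ht hτ⟩
  · rintro b ⟨τ, hτ, rfl⟩
    obtain ⟨hKE, hZ⟩ := horb τ hτ
    have hW := hfloor τ hτ
    rw [hw_def] at hW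
    refine ⟨?_, ?_, ?_⟩
    · simpa only [hflow τ] using hKE
    · simpa only [hflow τ] using hW
    · simpa only [hflow τ] using hZ

/-- **Registered tools stub: the bet closes the crux** (`BoundedExcessLoudCore → UniformGalerkinTrap`), composition of
the two theorems above. [folklore] -/
theorem stub_uniformGalerkinTrap_of_boundedExcessLoudCore :
    (∃ (m : ℕ) (f : UnitAddTorus (Fin 3) → EuclideanSpace ℝ (Fin 3)),
      ((IsSmooth f ∧ IsDivFree f ∧ ∀ k : Fin 3 → ℤ, ((m : ℕ) : ℝ) ^ 2 < freqNormSq k →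
        UnitAddTorus.mFourierCoeff (EuclideanSpace.complexify ∘ f) k = 0) ∧ HasZeroMean f) ∧
      ∃ (E ε₀ ν₀ : ℝ), 0 < ε₀ ∧ 0 < ν₀ ∧
        ∀ ν : ℝ, 0 < ν → ν ≤ ν₀ → ∃ (G : ℝ≥0) (N₀ : ℕ), ∀ N : ℕ, N₀ ≤ N →
          ∃ (β C L : ℝ) (μ : Measure (↥(freqBall (d := Fin 3) N) → EuclideanSpace ℂ (Fin 3))),
            0 ≤ L ∧ Real.sqrt (2 * C * L) ≤ β - ε₀ ∧
            IsProbabilityMeasure μ ∧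
            (∀ t : ℝ, 0 ≤ t →
              μ.map (galerkinCoeffFlow ν (fourierRestrict (freqBall (d := Fin 3) N) f) t) = μ) ∧
            μ {c : ↥(freqBall (d := Fin 3) N) → EuclideanSpace ℂ (Fin 3) |
                c ∈ galerkinSubspace (freqBall (d := Fin 3) N) ∧
                kineticEnergy (realTrigPoly (freqBall N) (coeffExt (freqBall N) c)) ≤ E ∧
                eGradNormSq (realTrigPoly (freqBall N) (coeffExt (freqBall N) c)) ≤ (G : ℝ≥0∞)}ᶜ = 0 ∧
            ∫ c, (∫ x, ⟪f x, realTrigPoly (freqBall N) (coeffExt (freqBall N) c) x⟫_ℝ) ∂μ = β ∧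
            (∀ᵐ c ∂μ, ∀ s t : ℝ, 0 ≤ s → 0 ≤ t →
              |(∫ x, ⟪f x, realTrigPoly (freqBall N) (coeffExt (freqBall N)
                  (galerkinCoeffFlow ν (fourierRestrict (freqBall (d := Fin 3) N) f) t c)) x⟫_ℝ) -
                ∫ x, ⟪f x, realTrigPoly (freqBall N) (coeffExt (freqBall N)
                  (galerkinCoeffFlow ν (fourierRestrict (freqBall (d := Fin 3) N) f) s c)) x⟫_ℝ| ≤
                L * |t - s|) ∧
            (∀ᵐ c ∂μ, ∀ t : ℝ, 0 ≤ t →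
              ∫ τ in (0 : ℝ)..t, (∫ x, ⟪f x, realTrigPoly (freqBall N) (coeffExt (freqBall N)
                (galerkinCoeffFlow ν (fourierRestrict (freqBall (d := Fin 3) N) f) τ c)) x⟫_ℝ) ≤
                β * t + C)) →
    Summit.AnomalousDissipation.AnomalousDissipation.Theses.WazewskiBlock.UniformGalerkinTrap :=
  fun h => uniformGalerkinTrap_of_boundedDeficitLoudCore (boundedDeficitLoudCore_of_boundedExcessLoudCore h)

end Summit.AnomalousDissipation.AnomalousDissipation.Theorems.UniformGalerkinTrap.Mane

end
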